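import Mathlib.Analysis.Complex.Basic
import Mathlib.Analysis.SpecialFunctions.Pow.Real
import Mathlib.Analysis.SpecialFunctions.Sqrt
import Mathlib.Algebra.Order.BigOperators.Group.Finset
import HarnessLib

/-!
# Sums of complex numbers of prescribed moduli (the Minkowski sum of circles)

Topic: `Literature/Analysis/Complex`. Everything in this file is PROVED; it is the elementary
plane geometry behind Bohr's description of the values of a Dirichlet polynomial on a vertical line
(the "addition of convex curves", Bohr 1913; Titchmarsh, *The Theory of the Riemann Zeta-Function*,
§11.5) and behind the reduction used by Platt–Trudgian for the sections of `ζ` (LMS J. Comput.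
Math. 19 (2016), §2.2: "`θ_{17}`, `θ_{19}` and `θ_{23}` only appear once in the sum … `ζ_{28}` cannot
have a zero if there is no `σ, θ_2, …, θ_{13}` such that `|ζ_{28'}| ≤ 17^{-σ} + 19^{-σ} + 23^{-σ}`",
and "a little high school geometry (the cosine rule to be precise)").

* `exists_unimodular_pair` — the cosine rule: if `|t − c| ≤ |z| ≤ t + c` (`t, c ≥ 0`) then
  `z = t u + c v` with `|u| = |v| = 1`.
* `exists_unimodular_sum_eq` — the set `{∑ r_i u_i : |u_i| = 1}` of sums of points on circles of
  radii `r_i ≥ 0` contains every `z` with `|z| ≤ ∑ r_i` and `2 r_i ≤ ∑_j r_j + |z|` for all `i`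
  (it is the closed annulus of outer radius `∑ r_i` and inner radius `max(0, 2 max r_i − ∑ r_i)`);
  in particular (`exists_unimodular_sum_eq_of_two_mul_le`) the whole closed disc of radius `∑ r_i`
  when no radius exceeds the sum of the others.

## References

* [Titchmarsh1986] E. C. Titchmarsh, *The Theory of the Riemann Zeta-Function*, 2nd ed., §11.5
  (Bohr's method: the values of `∑ c_n e^{iφ_n}` with independent phases).
* [PlattTrudgian2016] D. J. Platt, T. S. Trudgian, *Zeroes of partial sums of the zeta-function*,
  LMS J. Comput. Math. 19 (2016), 37–41, §2.2.
-/

noncomputable section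

namespace Literature.Analysis.Complex

open _root_.Complex

/-- **The cosine rule, solved for the phases.** If `t, c ≥ 0` and `|t − c| ≤ ‖z‖ ≤ t + c`, there
are unimodular `u, v` with `t u + c v = z` (a triangle with sides `t, c, ‖z‖`).
[cite: PlattTrudgian2016, §2.2] -/
theorem exists_unimodular_pair {t c : ℝ} (ht : 0 ≤ t) (hc : 0 ≤ c) {z : ℂ} (h1 : |t - c| ≤ ‖z‖)
    (h2 : ‖z‖ ≤ t + c) : ∃ u v : ℂ, ‖u‖ = 1 ∧ ‖v‖ = 1 ∧ t * u + c * v = z := by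
  -- reduce to `z = ρ > 0` real
  rcases eq_or_ne z 0 with rfl | hz
  · have htc : t = c := by
      rw [norm_zero] at h1
      have := abs_nonneg (t - c)
      have h0 : |t - c| = 0 := le_antisymm h1 this
      linarith [abs_eq_zero.1 h0]
    refine ⟨1, -1, by simp, by simp, ?_⟩
    rw [htc]; ring
  set ρ : ℝ := ‖z‖ with hρ
  have hρ0 : 0 < ρ := norm_pos_iff.2 hz
  set w : ℂ := z / ρ with hw
  have hwn : ‖w‖ = 1 := by
    rw [hw, norm_div, Complex.norm_real, Real.norm_eq_abs, abs_of_pos hρ0, ← hρ, div_self hρ0.ne']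
  have hzw : z = ρ * w := by
    rw [hw, mul_div_cancel₀ _ (by exact_mod_cast hρ0.ne')]
  -- it suffices to solve `t u₀ + c v₀ = ρ`
  suffices H : ∃ u₀ v₀ : ℂ, ‖u₀‖ = 1 ∧ ‖v₀‖ = 1 ∧ t * u₀ + c * v₀ = ρ by
    obtain ⟨u₀, v₀, hu₀, hv₀, he⟩ := H
    refine ⟨w * u₀, w * v₀, by rw [norm_mul, hwn, hu₀, one_mul],
      by rw [norm_mul, hwn, hv₀, one_mul], ?_⟩
    calc t * (w * u₀) + c * (w * v₀) = w * (t * u₀ + c * v₀) := by ring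
      _ = z := by rw [he, mul_comm, ← hzw]
  have hρtc : |t - c| ≤ ρ := h1
  have hρtc' : ρ ≤ t + c := h2
  rcases eq_or_lt_of_le ht with rfl | htpos
  · -- `t = 0`: then `ρ = c`
    have hρc : ρ = c := by
      rw [zero_sub, abs_neg, abs_of_nonneg hc] at hρtc
      linarith
    exact ⟨1, 1, by simp, by simp, by rw [hρc]; push_cast; ring⟩
  rcases eq_or_lt_of_le hc with rfl | hcpos
  · -- `c = 0`: then `ρ = t`
    have hρt : ρ = t := by
      rw [sub_zero, abs_of_nonneg ht] at hρtc
      linarith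
    exact ⟨1, 1, by simp, by simp, by rw [hρt]; push_cast; ring⟩
  -- the cosine rule: `x = cos φ = (t² + ρ² − c²)/(2tρ) ∈ [−1, 1]`
  set x : ℝ := (t ^ 2 + ρ ^ 2 - c ^ 2) / (2 * t * ρ) with hx
  have h2tρ : 0 < 2 * t * ρ := by positivity
  have habs := abs_le.1 hρtc
  have hx1 : x ≤ 1 := by
    rw [hx, div_le_one h2tρ]
    nlinarith [habs.1, habs.2]
  have hx2 : -1 ≤ x := by
    rw [hx, le_div_iff₀ h2tρ]
    nlinarith [habs.1, habs.2]
  have hxx : 0 ≤ 1 - x ^ 2 := by nlinarith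
  set y : ℝ := Real.sqrt (1 - x ^ 2) with hy
  have hy2 : y ^ 2 = 1 - x ^ 2 := by rw [hy, Real.sq_sqrt hxx]
  set u₀ : ℂ := (x : ℂ) + (y : ℂ) * I with hu₀
  have hu₀n : ‖u₀‖ = 1 := by
    have h : ‖u₀‖ ^ 2 = 1 := by
      rw [Complex.sq_norm, Complex.normSq_apply]
      simp only [hu₀, add_re, ofReal_re, mul_re, I_re, mul_zero, ofReal_im, I_im, mul_one,
        sub_self, add_zero, add_im, mul_im, zero_add]
      nlinarith [hy2]
    have hn := norm_nonneg u₀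
    nlinarith [h, hn]
  -- `v₀ = (ρ − t u₀)/c` is unimodular
  set v₀ : ℂ := ((ρ : ℂ) - t * u₀) / c with hv₀
  have hkey : ‖(ρ : ℂ) - t * u₀‖ = c := by
    have h : ‖(ρ : ℂ) - t * u₀‖ ^ 2 = c ^ 2 := by
      rw [Complex.sq_norm, Complex.normSq_apply]
      simp only [hu₀, sub_re, ofReal_re, mul_re, add_re, I_re, mul_zero, ofReal_im, I_im,
        mul_one, sub_self, add_zero, add_im, mul_im, zero_add, sub_im, zero_sub]
      have hxdef : x * (2 * t * ρ) = t ^ 2 + ρ ^ 2 - c ^ 2 := by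
        rw [hx, div_mul_cancel₀ _ h2tρ.ne']
      nlinarith [hy2, hxdef]
    have hn := norm_nonneg ((ρ : ℂ) - t * u₀)
    nlinarith [h, hn]
  have hv₀n : ‖v₀‖ = 1 := by
    rw [hv₀, norm_div, hkey, Complex.norm_real, Real.norm_eq_abs, abs_of_pos hcpos,
      div_self hcpos.ne']
  refine ⟨u₀, v₀, hu₀n, hv₀n, ?_⟩
  rw [hv₀, mul_div_cancel₀ _ (by exact_mod_cast hcpos.ne')]
  ring

/-- **Sums of points on circles.** For radii `r_i ≥ 0` (`i ∈ s`) and `z ∈ ℂ` with `‖z‖ ≤ ∑ r_i`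
and `2 r_i ≤ ∑_j r_j + ‖z‖` for every `i`, there are unimodular `u_i` with `∑ r_i u_i = z`: the
Minkowski sum of the circles `|w| = r_i` is the closed annulus
`max(0, 2 max_i r_i − ∑ r_i) ≤ |w| ≤ ∑ r_i`. (Induction on the number of circles: peel off one
circle with the cosine rule, `exists_unimodular_pair`.) [cite: Titchmarsh1986, §11.5] -/
theorem exists_unimodular_sum_eq {ι : Type*} (s : Finset ι) (r : ι → ℝ)
    (hr : ∀ i ∈ s, 0 ≤ r i) (z : ℂ) (hz : ‖z‖ ≤ ∑ i ∈ s, r i)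
    (hbig : ∀ i ∈ s, 2 * r i ≤ (∑ j ∈ s, r j) + ‖z‖) :
    ∃ u : ι → ℂ, (∀ i ∈ s, ‖u i‖ = 1) ∧ ∑ i ∈ s, (r i : ℂ) * u i = z := by
  classical
  induction s using Finset.induction_on generalizing z with
  | empty =>
    refine ⟨fun _ ↦ 1, fun i hi ↦ by simp, ?_⟩
    rw [Finset.sum_empty] at hz
    rw [Finset.sum_empty, eq_comm]
    exact norm_le_zero_iff.1 hz
  | insert i₀ s hi₀ ih =>
    set S : ℝ := ∑ j ∈ s, r j with hS
    set c : ℝ := r i₀ with hc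
    have hc0 : 0 ≤ c := hr i₀ (Finset.mem_insert_self _ _)
    have hrs : ∀ i ∈ s, 0 ≤ r i := fun i hi ↦ hr i (Finset.mem_insert_of_mem hi)
    have hS0 : 0 ≤ S := Finset.sum_nonneg hrs
    rw [Finset.sum_insert hi₀] at hz hbig
    have hbig₀ : 2 * c ≤ c + S + ‖z‖ := hbig i₀ (Finset.mem_insert_self _ _)
    have hbigs : ∀ i ∈ s, 2 * r i ≤ c + S + ‖z‖ := fun i hi ↦ hbig i (Finset.mem_insert_of_mem hi)
    have hris : ∀ i ∈ s, r i ≤ S := fun i hi ↦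
      Finset.single_le_sum (f := r) hrs hi
    -- the modulus of the partial sum over `s`
    set t : ℝ := min S (‖z‖ + c) with ht
    have ht0 : 0 ≤ t := le_min hS0 (by positivity)
    have htS : t ≤ S := min_le_left _ _
    have htz : t ≤ ‖z‖ + c := min_le_right _ _
    have hcases : t = S ∨ t = ‖z‖ + c := min_choice _ _
    -- triangle with sides `t, c, ‖z‖`
    have h1 : |t - c| ≤ ‖z‖ := by
      rw [abs_le]
      constructor
      · rcases hcases with h | h
        · rw [h]; linarith
        · rw [h]; linarith [norm_nonneg z]
      · linarith
    have h2 : ‖z‖ ≤ t + c := by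
      rcases hcases with h | h
      · rw [h]; linarith
      · rw [h]; linarith
    obtain ⟨u₀, v₀, hu₀, hv₀, he⟩ := exists_unimodular_pair ht0 hc0 h1 h2
    -- represent `w = t u₀` by the circles of `s`
    set w : ℂ := t * u₀ with hw
    have hwn : ‖w‖ = t := by
      rw [hw, norm_mul, hu₀, mul_one, Complex.norm_real, Real.norm_eq_abs, abs_of_nonneg ht0]
    have hwS : ‖w‖ ≤ ∑ j ∈ s, r j := by rw [hwn]; exact htS
    have hwbig : ∀ i ∈ s, 2 * r i ≤ (∑ j ∈ s, r j) + ‖w‖ := by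
      intro i hi
      rw [hwn, ← hS]
      rcases hcases with h | h
      · rw [h]; linarith [hris i hi]
      · rw [h]; linarith [hbigs i hi]
    obtain ⟨u', hu'n, hu's⟩ := ih (fun i hi ↦ hrs i hi) w hwS hwbig
    refine ⟨Function.update u' i₀ v₀, fun i hi ↦ ?_, ?_⟩
    · rcases Finset.mem_insert.1 hi with rfl | hi
      · rw [Function.update_self]; exact hv₀
      · rw [Function.update_of_ne (ne_of_mem_of_not_mem hi hi₀)]; exact hu'n i hi
    · rw [Finset.sum_insert hi₀, Function.update_self]
      have hsum : ∑ i ∈ s, (r i : ℂ) * Function.update u' i₀ v₀ i = ∑ i ∈ s, (r i : ℂ) * u' i := by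
        refine Finset.sum_congr rfl fun i hi ↦ ?_
        rw [Function.update_of_ne (ne_of_mem_of_not_mem hi hi₀)]
      rw [hsum, hu's, hw, ← he, hc]
      ring

/-- **The disc case.** If no radius exceeds the sum of the others (`2 r_i ≤ ∑_j r_j` for all `i`),
every `z` with `‖z‖ ≤ ∑ r_i` is a sum `∑ r_i u_i` with all `u_i` unimodular.
[cite: Titchmarsh1986, §11.5] -/
theorem exists_unimodular_sum_eq_of_two_mul_le {ι : Type*} (s : Finset ι) (r : ι → ℝ)
    (hr : ∀ i ∈ s, 0 ≤ r i) (hbig : ∀ i ∈ s, 2 * r i ≤ ∑ j ∈ s, r j) (z : ℂ)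
    (hz : ‖z‖ ≤ ∑ i ∈ s, r i) :
    ∃ u : ι → ℂ, (∀ i ∈ s, ‖u i‖ = 1) ∧ ∑ i ∈ s, (r i : ℂ) * u i = z :=
  exists_unimodular_sum_eq s r hr z hz fun i hi ↦ (hbig i hi).trans (by linarith [norm_nonneg z])

end Literature.Analysis.Complex
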